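import Summits.Ventures.CertifiedArithmetic.LowPrec.AccumulateSharp

/-!
# Kahan's compensated summation (returning `ŝ`): an explicit error envelope in every format

HONEST FRAMING (venture CertifiedArithmetic / cell `pub-lowprec`): certified error envelopes and
provably optimal rounding/accumulation schemes for low-precision formats under stated cost models;
every table by two implementations; no hardware or vendor claims.

KAHAN's compensated recursive summation [Kahan 1965; Higham2002ASNA, Alg. 4.2; BoldoEtAl2023,
§5.3 Alg. 20], in the form of the cell's GEMM model (`kahan`: `ŝ ← x₀`, `c ← 0`; for each further
summand `y ← fl(x + c)`, `t ← fl(ŝ + y)`, `c ← fl(fl(ŝ - t) + y)`, `ŝ ← t`; RETURN `ŝ` — the final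
`c` is not added), every operation one rounding `fl = roundNE α` (round-to-nearest-even,
saturating). The literature records only ASYMPTOTIC forms for this algorithm — `3u + O(u²)`-type
first-order constants for the returned `ŝ` [HallmanIpsen2023, Cor. 20 / Rem. 21] and
`2u + O(nu²)` for `ŝ + c` [Knuth TAOCP §4.2.2 Ex. 19; Goldberg 1991 Thm 8; Higham2002ASNA (4.9)]
— "the constants are not explicit in the sources" (cell note GEMM-BOUNDS C1). THIS DEVELOPMENT (the
algorithm and its exact error recursion here, the summation in `KahanEnvelope.lean`) PROVES AN
EXPLICIT ENVELOPE for every format `α` with `emaxCode ≥ 2` and `u ≤ 1/8` (all of binary16/32,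
bfloat16, OCP `E4M3`, `E5M2`, `E3M2`, `E2M3`): for summands `x₀ … xₙ ∈ F_α` (`n` compensated
steps), every operation in range, and any `T` bounding the computed partial sums `|ŝₖ| ≤ T`,

  `|ŝₙ - Σ xᵢ| ≤ u·|ŝₙ| + (2u + 6u²)·Σ|xᵢ| + 6·n·u²·T`       (`MiniFloat.abs_kahan_sub_sum_le`).

First-order content: `u|ŝₙ| + 2u Σ|xᵢ|` (≤ `3u Σ|xᵢ|` to first order, the Hallman–Ipsen constant);
the `u|ŝₙ|` term is the uncompensated LAST rounding error (the algorithm returns `ŝ`, not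
`ŝ + c`). Structure of the proof (the bit-model, not the `(1+δ)`-model): with `e = t - (ŝ + y)`
the exact error of the main addition, the computed correction is `c' = -e + r` where the
perturbation `r` (two further roundings) satisfies `|r| ≤ u(1+u)|y| + u(2+u)|e|`
(`abs_kahanR_le`); the compensated error `F = ŝ + c - Σx` obeys the EXACT recursion
`Fₖ₊₁ = Fₖ + ηₖ + rₖ` (`kahanF_succ`, `η` the rounding error of `y`), and `ŝₙ - Σx = Fₙ₋₁ + η + e`;
summing the local bounds with `|eₖ| ≤ u|ŝₖ₊₁|`, `|cₖ| ≤ u(1+u)²(|xₖ| + T + |cₖ₋₁|)` gives the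
envelope. Constants `6, 6` are crude roundings of `2 + O(u)` polynomial expressions at `u ≤ 1/8`;
no attempt at sharpness in the second-order terms.

Deliberately NOT here: the `ŝ + c` variant, a `T`-free corollary (take `T` from the range
analysis of the caller, e.g. `AccumulateRange.lean` style), lower bounds / attained witnesses (the
cell's certified `W_kahan(3) = 1/289`, `W_kahan(4) = 1/257` rows are exhaustive tables, GEMM note).
-/

namespace Literature.ComputerArithmetic.FloatingPoint

namespace MiniFloat

open Finset

variable {α : Format}

/-! ### The algorithm -/

/-- Kahan's compensated summation in format `α`, state `(ŝₖ, cₖ)` after summands `x 0, …, x k`: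
`ŝ₀ = fl(x₀)`, `c₀ = 0`; `y = fl(xₖ₊₁ + cₖ)`, `ŝₖ₊₁ = fl(ŝₖ + y)`, `cₖ₊₁ = fl(fl(ŝₖ - ŝₖ₊₁) + y)`.
[cite: Higham2002ASNA, Alg. 4.2] -/
def kahan (α : Format) (x : ℕ → ℚ) : ℕ → ℚ × ℚ
  | 0 => (flα α (x 0), 0)
  | k + 1 =>
      (flα α ((kahan α x k).1 + flα α (x (k + 1) + (kahan α x k).2)),
       flα α (flα α ((kahan α x k).1
          - flα α ((kahan α x k).1 + flα α (x (k + 1) + (kahan α x k).2)))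
          + flα α (x (k + 1) + (kahan α x k).2)))

/-- The corrected summand of step `k + 1`: `yₖ = fl(xₖ₊₁ + cₖ)`. [cite: Higham2002ASNA, Alg. 4.2] -/
def kahanY (α : Format) (x : ℕ → ℚ) (k : ℕ) : ℚ := flα α (x (k + 1) + (kahan α x k).2)

/-- Step equation for `ŝ`. [folklore] -/
theorem kahan_succ_fst (x : ℕ → ℚ) (k : ℕ) :
    (kahan α x (k + 1)).1 = flα α ((kahan α x k).1 + kahanY α x k) := rfl

/-- Step equation for `c`. [folklore] -/
theorem kahan_succ_snd (x : ℕ → ℚ) (k : ℕ) :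
    (kahan α x (k + 1)).2
      = flα α (flα α ((kahan α x k).1 - (kahan α x (k + 1)).1) + kahanY α x k) := rfl

/-- `c₀ = 0`. [folklore] -/
@[simp] theorem kahan_zero_snd (x : ℕ → ℚ) : (kahan α x 0).2 = 0 := rfl

/-- `ŝ₀ = fl(x₀)`. [folklore] -/
theorem kahan_zero_fst (x : ℕ → ℚ) : (kahan α x 0).1 = flα α (x 0) := rfl

/-- `ŝₖ` is a value of `α`. [folklore] -/
theorem exists_toRat_eq_kahan_fst (x : ℕ → ℚ) : ∀ k, ∃ y : MiniFloat α, y.toRat = (kahan α x k).1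
  | 0 => ⟨roundNE α (x 0), rfl⟩
  | _ + 1 => ⟨roundNE α _, rfl⟩

/-- `cₖ` is a value of `α`. [folklore] -/
theorem exists_toRat_eq_kahan_snd (x : ℕ → ℚ) : ∀ k, ∃ y : MiniFloat α, y.toRat = (kahan α x k).2
  | 0 => ⟨zero α, by simp⟩
  | _ + 1 => ⟨roundNE α _, rfl⟩

/-- `yₖ` is a value of `α`. [folklore] -/
theorem exists_toRat_eq_kahanY (x : ℕ → ℚ) (k : ℕ) : ∃ y : MiniFloat α, y.toRat = kahanY α x k :=
  ⟨roundNE α _, rfl⟩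

/-! ### Local rounding facts for values of the format -/

/-- Standard model for a sum of two VALUES (gradual underflow included): `|fl(p+q) - (p+q)| ≤
u|p + q|` in range. [cite: Higham2002ASNA, Thm 2.2] -/
theorem abs_fl_add_sub_le (hα : 2 ≤ α.emaxCode) {p q : ℚ} (hp : ∃ a : MiniFloat α, a.toRat = p)
    (hq : ∃ b : MiniFloat α, b.toRat = q) (hr : |p + q| ≤ α.maxRat) :
    |flα α (p + q) - (p + q)| ≤ α.unitRoundoff * |p + q| := by
  obtain ⟨a, rfl⟩ := hp
  obtain ⟨b, rfl⟩ := hq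
  have h := abs_err_roundNE_add_le_sharp hα a b hr
  have hu := α.unitRoundoff_pos
  refine le_trans h (mul_le_mul_of_nonneg_right ?_ (abs_nonneg _))
  rw [div_le_iff₀ (by linarith)]
  nlinarith [abs_nonneg (a.toRat + b.toRat)]

/-- The same error measured by the COMPUTED result: `|fl(p+q) - (p+q)| ≤ u|fl(p+q)|` (from the
sharp `u/(1+u)` bound). [cite: JeannerodRump2018, Thm 2.1] -/
theorem abs_fl_add_sub_le_result (hα : 2 ≤ α.emaxCode) {p q : ℚ}
    (hp : ∃ a : MiniFloat α, a.toRat = p) (hq : ∃ b : MiniFloat α, b.toRat = q)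
    (hr : |p + q| ≤ α.maxRat) :
    |flα α (p + q) - (p + q)| ≤ α.unitRoundoff * |flα α (p + q)| := by
  obtain ⟨a, rfl⟩ := hp
  obtain ⟨b, rfl⟩ := hq
  have h := abs_err_roundNE_add_le_sharp hα a b hr
  have hu := α.unitRoundoff_pos
  unfold flα
  set f := (roundNE α (a.toRat + b.toRat)).toRat
  set z := a.toRat + b.toRat
  -- |z| ≤ |f| + |f - z|
  have h1 : |z| ≤ |f| + |f - z| := by
    have := abs_sub_abs_le_abs_sub z f
    rw [abs_sub_comm] at this; linarith
  have h2 : |f - z| * (1 + α.unitRoundoff) ≤ α.unitRoundoff * |z| := by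
    rw [div_mul_eq_mul_div, le_div_iff₀ (by linarith)] at h; linarith
  nlinarith [abs_nonneg (f - z), abs_nonneg f]

/-- Differences: `p - q` with `q` a value is `p + (-q)` with `-q` a value. [folklore] -/
theorem exists_toRat_eq_neg {q : ℚ} (hq : ∃ b : MiniFloat α, b.toRat = q) :
    ∃ b : MiniFloat α, b.toRat = -q := by
  obtain ⟨b, rfl⟩ := hq; exact ⟨flipSign b, toRat_flipSign b⟩

/-! ### The local error terms of one step -/

/-- `|ηₖ| ≤ u|xₖ₊₁ + cₖ|` for the rounding error `ηₖ = yₖ - (xₖ₊₁ + cₖ)`. [folklore] -/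
theorem abs_kahanEta_le (hα : 2 ≤ α.emaxCode) (x : ℕ → ℚ) (k : ℕ)
    (hxk : ∃ y : MiniFloat α, y.toRat = x (k + 1))
    (hr : |x (k + 1) + (kahan α x k).2| ≤ α.maxRat) :
    |kahanY α x k - (x (k + 1) + (kahan α x k).2)|
      ≤ α.unitRoundoff * |x (k + 1) + (kahan α x k).2| :=
  abs_fl_add_sub_le hα hxk (exists_toRat_eq_kahan_snd x k) hr

/-- `|eₖ| ≤ u|ŝₖ₊₁|` for the error `eₖ = ŝₖ₊₁ - (ŝₖ + yₖ)` of the main addition. [folklore] -/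
theorem abs_kahanE_le (hα : 2 ≤ α.emaxCode) (x : ℕ → ℚ) (k : ℕ)
    (hr : |(kahan α x k).1 + kahanY α x k| ≤ α.maxRat) :
    |(kahan α x (k + 1)).1 - ((kahan α x k).1 + kahanY α x k)|
      ≤ α.unitRoundoff * |(kahan α x (k + 1)).1| := by
  rw [kahan_succ_fst]
  exact abs_fl_add_sub_le_result hα (exists_toRat_eq_kahan_fst x k) (exists_toRat_eq_kahanY x k) hr

/-- THE COMPENSATION DEFECT: `cₖ₊₁ = -eₖ + rₖ` with `|rₖ| ≤ u(1+u)|yₖ| + u(2+u)|eₖ|` (two further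
roundings; `rₖ = 0` whenever `|yₖ| ≤ |ŝₖ|`, by Fast2Sum — not used here). [folklore] -/
theorem abs_kahanR_le (hα : 2 ≤ α.emaxCode) (x : ℕ → ℚ) (k : ℕ)
    (hr3 : |(kahan α x k).1 - (kahan α x (k + 1)).1| ≤ α.maxRat)
    (hr4 : |flα α ((kahan α x k).1 - (kahan α x (k + 1)).1) + kahanY α x k| ≤ α.maxRat) :
    |(kahan α x (k + 1)).2 + ((kahan α x (k + 1)).1 - ((kahan α x k).1 + kahanY α x k))|
      ≤ α.unitRoundoff * (1 + α.unitRoundoff) * |kahanY α x k|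
        + α.unitRoundoff * (2 + α.unitRoundoff)
          * |(kahan α x (k + 1)).1 - ((kahan α x k).1 + kahanY α x k)| := by
  have hu := α.unitRoundoff_pos
  set s := (kahan α x k).1 with hs
  set s' := (kahan α x (k + 1)).1 with hs'
  set y := kahanY α x k with hy
  set e := s' - (s + y) with he
  set d := flα α (s - s') with hd
  have hsF := exists_toRat_eq_kahan_fst (α := α) x k
  have hs'F := exists_toRat_eq_kahan_fst (α := α) x (k + 1)
  have hyF := exists_toRat_eq_kahanY (α := α) x k
  -- ρ = d - (s - s'), |ρ| ≤ u |s - s'| = u |y + e|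
  have hss : |s - s'| = |y + e| := by rw [show s - s' = -(y + e) by rw [he]; ring, abs_neg]
  have hρ : |d - (s - s')| ≤ α.unitRoundoff * |y + e| := by
    have := abs_fl_add_sub_le hα hsF (exists_toRat_eq_neg hs'F)
      (by rw [← sub_eq_add_neg]; exact hr3)
    rw [← sub_eq_add_neg, ← hd, hss] at this
    exact this
  -- σ = c' - (d + y), |σ| ≤ u |d + y|
  have hσ : |(kahan α x (k + 1)).2 - (d + y)| ≤ α.unitRoundoff * |d + y| := by
    rw [kahan_succ_snd]
    exact abs_fl_add_sub_le hα ⟨roundNE α _, rfl⟩ hyF hr4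
  -- d + y = (d - (s - s')) - e
  have hdy : d + y = (d - (s - s')) - e := by rw [he]; ring
  have h1 : |d + y| ≤ |d - (s - s')| + |e| := by rw [hdy]; exact abs_sub _ _
  -- c' + e = σ + (d + y) + e = σ + ρ
  have h2 : (kahan α x (k + 1)).2 + e = ((kahan α x (k + 1)).2 - (d + y)) + (d - (s - s')) := by
    rw [hdy]; ring
  have hye : |y + e| ≤ |y| + |e| := abs_add_le _ _
  have h3 := mul_le_mul_of_nonneg_left h1 hu.le
  have h4 := mul_le_mul_of_nonneg_left hρ hu.le
  have h5 := mul_le_mul_of_nonneg_left hye hu.le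
  have h6 := mul_le_mul_of_nonneg_left hye (mul_nonneg hu.le hu.le)
  calc |(kahan α x (k + 1)).2 + e|
      ≤ |(kahan α x (k + 1)).2 - (d + y)| + |d - (s - s')| := by rw [h2]; exact abs_add_le _ _
    _ ≤ α.unitRoundoff * |d + y| + α.unitRoundoff * |y + e| := add_le_add hσ hρ
    _ ≤ α.unitRoundoff * (|d - (s - s')| + |e|) + α.unitRoundoff * |y + e| := by linarith
    _ ≤ α.unitRoundoff * (α.unitRoundoff * |y + e| + |e|) + α.unitRoundoff * |y + e| := by
        linarith
    _ ≤ α.unitRoundoff * (1 + α.unitRoundoff) * |y|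
        + α.unitRoundoff * (2 + α.unitRoundoff) * |e| := by linarith

/-! ### The exact recursion of the compensated error -/

/-- `Fₖ = ŝₖ + cₖ - Σ_{i≤k} xᵢ`, the error of the compensated pair. [folklore] -/
def kahanF (α : Format) (x : ℕ → ℚ) (k : ℕ) : ℚ :=
  (kahan α x k).1 + (kahan α x k).2 - ∑ i ∈ range (k + 1), x i

/-- `F₀ = 0` for `x₀ ∈ F_α`. [folklore] -/
theorem kahanF_zero (x : ℕ → ℚ) (hx0 : ∃ y : MiniFloat α, y.toRat = x 0) : kahanF α x 0 = 0 := by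
  unfold kahanF
  rw [kahan_zero_fst, kahan_zero_snd, range_one, sum_singleton]
  unfold flα; rw [toRat_roundNE_of_exists hx0]; ring

/-- EXACT RECURSION: `Fₖ₊₁ = Fₖ + ηₖ + rₖ` where `ηₖ = yₖ - (xₖ₊₁ + cₖ)` and
`rₖ = cₖ₊₁ + eₖ`, `eₖ = ŝₖ₊₁ - (ŝₖ + yₖ)` (an algebraic identity). [folklore] -/
theorem kahanF_succ (x : ℕ → ℚ) (k : ℕ) :
    kahanF α x (k + 1) = kahanF α x k + (kahanY α x k - (x (k + 1) + (kahan α x k).2))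
      + ((kahan α x (k + 1)).2 + ((kahan α x (k + 1)).1 - ((kahan α x k).1 + kahanY α x k))) := by
  unfold kahanF
  rw [sum_range_succ]
  ring

/-- The returned error: `ŝₙ₊₁ - Σ_{i≤n+1} xᵢ = Fₙ + ηₙ + eₙ`. [folklore] -/
theorem kahan_fst_sub_sum (x : ℕ → ℚ) (n : ℕ) :
    (kahan α x (n + 1)).1 - ∑ i ∈ range (n + 2), x i
      = kahanF α x n + (kahanY α x n - (x (n + 1) + (kahan α x n).2))
        + ((kahan α x (n + 1)).1 - ((kahan α x n).1 + kahanY α x n)) := by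
  unfold kahanF
  rw [sum_range_succ _ (n + 1)]
  ring

end MiniFloat

end Literature.ComputerArithmetic.FloatingPoint
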